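import Summits.QuantumFields.YangMills.Theorems.BalabanUVNodesN07SplitClauseLevelRaising
import HarnessLib

/-!
# N07 [B11] (= [15] = [Balaban1985Variational]) Sect. F, S6 HEAD — LEVEL RAISING WITH PRINT's MARGIN (plan g87 YMPLAN-G87-N07-ADJRING, cure (c2) of LOCATED-ADJACENT-RING): the
# per-datum token from its restriction to the **MARGIN-CLEAN** datums — those whose print box WIDENED BY ONE LEVEL-`j` BLOCK carries no point of `Ω_{j+1}` — by raising the level with a
# BLOCK tolerance (the widened level-`j` box sits inside a level-`(j+1)` print box)

Cell `pub-ymgap`, seat `pub-ymgap-dag-n07-e` g23 (FAN-OUT §N07 row s3; LANE OWNER of the K0 road), MODULE 64, pen named by plan g87 (cell bus 2026-08-28T19:10:59Z: «(c2): strengthen the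
head's CLEAN premise to print's MARGIN form … and give MODULE 56's level raising a BLOCK tolerance … Pen: n07-e»).  `--kind proof --supports stmt-QuantumFields-20541 --as helper` (K0⁷);
count-neutral; def-free.  [15] = [Balaban1985Variational]; [6] = [Balaban1985RegularSpaces].

WHY (LOCATED-ADJACENT-RING, n07-e g23 bus 2026-08-28T19:11Z).  The chart's canonical top box is the print box `𝔔(j, a)` WIDENED by one ring of level-`j` blocks (`[sqLo_j − 1, sqHi_j + 1]`;
the tree's constraint bonds are inclusive, so outer ends stick out one step).  MODULE 56 (`…N07SplitClauseLevelRaising`, p639318) reduced the token to the datums whose PRINT BOX misses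
`Ω_{j+1}`; at such a datum the RING may still meet `Ω_{j+1}`, and there the top rows' supplier («(7) for V» on the widened box, MODULE 62 p660006) meets plaquettes with a bond inside
`Ω_{j+1}^{(j)}` — not print's (7) plaquettes.  Print's device is the MARGIN ((144): `dist(□, □̃ᶜ) = 2R₁M₁Lʲη`, «□̃ ⊂ B_{j−1}(Λ_{j−1}) ∪ B_j(Λ_j)»): the clean condition is asked of a cube
LARGER than the one the conclusion is read on.  THIS FILE is MODULE 56 §3–§4 with that margin: if the WIDENED box `box L (cornerP a − 1) (sideP + 2) j` carries a point of `Ω_{j+1}`, the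
level is raised — the widened box lies in a level-`(j+1)` print box of the same letters (§1: corner `ρ·⌊(q − 1)∕L⌋`, using `L ≥ 3` and the print side's factor `s ≥ 2`), whose meeting premise
is witnessed by that very point; so the token at EVERY meeting datum follows from the clause at the meeting datums that are MARGIN-CLEAN: `j = k ∨` «the widened box misses `Ω_{j+1}`» (§2–§3).

WHAT IS PROVED (sorry-free; no definition; axioms standard; integer box arithmetic + MODULE 56's `.raise` by name — NOTHING of [15]∕[6] analysis).
§1 `box_subset_wbox` (the print box inside its widening) · ★ `exists_cornerP_wbox_subset_succ` (`1 ≤ Mc ≤ ρ`, `3 ≤ L`: the widened level-`n` print box lies in a level-`(n+1)` print box).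
§2 ★★★ `localGaugeSplitOn_allDatums_of_marginClean` (generic torus, any `Ω`, any `U`: all meeting datums from the MARGIN-CLEAN meeting datums; induction on `k − j`).
§3 ★★★ `datumGaugeSplitTopStepCoreG_of_marginClean F N` — dag-n07-w4's guarded per-datum token from the SAME clause supplied only at meeting, margin-clean datums; side letters
`1 ≤ Mc ≤ ρ`, `0 ≤ B₃ κ C θ Q`; `3 ≤ L` is `F.hL11`.  A knit keyed on it (MODULE 59's shape with the margin-clean premise in HS3NORM ∕ HCHART-MEET-NORM) then owes the chart's rows only
at datums whose widened top box misses `Ω_{j+1}` — where «(7) for V» holds on ALL of `boxPlaqs (sqLo_j − 1) (sqHi_j + 1)` (SPEC §10).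

HONEST SCOPE.  Count-neutral; a reduction between displayed shapes; the clause itself (S3 + chart + budget) is discharged by nobody here; stub 1-G‴ ∕ K0⁷ ∕ K1⁹ NOT closed; N07 NOT
discharged; counts unmoved (typed 28∕28 · discharged 5∕27); one finite 𝕋⁴ programme at fixed ε — the route closes the conditional finite-𝕋⁴ rung `BalabanLadder.UV` ONLY; the YM mass gap
(Clay) is NOT proved by any of this; nothing continuum ∕ ℝ⁴ ∕ OS.  No `sorry`, no `def`, no `instance`, no `notation`.

References: [15] (144) p. 300, p. 300 («□ intersecting Ω_j but not Ω_{j+1}»), (147)–(150) p. 301, (160) p. 303; [6] p. 98, (1.131) p. 99.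
-/

set_option autoImplicit false

noncomputable section
open scoped BigOperators Matrix.Norms.L2Operator

namespace Summit.QuantumFields.YangMills.BalabanUVNodes.N07SplitClauseLevelRaisingMargin

open Literature.MathematicalPhysics.QuantumFieldTheory.Balaban1983to89
open Literature.MathematicalPhysics.QuantumFieldTheory.Balaban1983to89.Node00
open Literature.MathematicalPhysics.QuantumFieldTheory.Balaban1983to89.B15DeterminingSets
open T4Continuum (T4Family)
open B15Eq112TorusCover (cover)
open B14DomainGeom (Pt Within)
open B14.Eq213MaximalDomains (side cubeExt)
open B8Eq131Cubes (box bLo bHi)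
open Summit.QuantumFields.YangMills.BalabanUVNodes.N07LocalLettersSplitCore (LocalGaugeSplitOn)
open Summit.QuantumFields.YangMills.BalabanUVNodes.N07LocalLettersCoreGuarded (DatumGaugeSplitTopStepCoreG)
open Summit.QuantumFields.YangMills.BalabanUVNodes.N07SplitClauseLevelRaising (box_subset_box_succ_of_corner cubeExt_side_subset_box_cornerP)

/-! ## §1  The widened print box, and its level-`(n+1)` print box -/

section Boxes

variable {P : Params}

/-- The print box lies in its widening by one block on each side: `box L c S n ⊆ box L (c − 1) (S + 2) n`. [cite: Balaban1985Variational, (144) p.300 (bookkeeping)] -/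
theorem box_subset_wbox (L : ℕ) (c : Pt P.d) (S n : ℕ) : box L c S n ⊆ box L (c - 1) (S + 2) n :=
  box_subset_box_of_corner L (fun i => by simp) (fun i => by simp only [Pi.sub_apply, Pi.one_apply]; push_cast; linarith) n

/-- ★ **THE WIDENED LEVEL-`n` PRINT BOX LIES IN A LEVEL-`(n+1)` PRINT BOX OF THE SAME LETTERS** (`1 ≤ Mc ≤ ρ`, `3 ≤ L`) — the BLOCK tolerance of the level raising: with
`cornerP Mc ρ a = ρ·q`, the level-`(n+1)` index `a⁺_i := ⌊(ρ⌊(q_i − 1)∕L⌋ + Mc − 1)∕Mc⌋` has print corner `ρ·⌊(q_i − 1)∕L⌋` (`Mc ≤ ρ`), and `L·ρ⌊(q−1)∕L⌋ ≤ ρq − 1`,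
`ρq + ρs + 1 ≤ L·(ρ⌊(q−1)∕L⌋ + ρs)` (`sideP = ρ·s`, `s ≥ 2`, `L ≥ 3`). [cite: Balaban1985Variational, (144) p.300 (the margin cube □̃); Balaban1985RegularSpaces, p.98] -/
theorem exists_cornerP_wbox_subset_succ {Mc ρ : ℕ} (hMc : 1 ≤ Mc) (hMcρ : Mc ≤ ρ) (hL : 3 ≤ P.L) (a : Pt P.d) (n : ℕ) :
    ∃ a' : Pt P.d, box P.L (cornerP P Mc ρ a - 1) (sideP P Mc ρ + 2) n ⊆ box P.L (cornerP P Mc ρ a') (sideP P Mc ρ) (n + 1) := by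
  have hρ0 : (0 : ℤ) < ρ := by exact_mod_cast (lt_of_lt_of_le hMc hMcρ)
  have hρ1 : (1 : ℤ) ≤ ρ := hρ0
  have hMc0 : (0 : ℤ) < Mc := by exact_mod_cast hMc
  have hL3 : (3 : ℤ) ≤ P.L := by exact_mod_cast hL
  have hL0 : (0 : ℤ) < P.L := by linarith
  -- the letters
  set q : Pt P.d := fun i => ((Mc : ℤ) * a i) / (ρ : ℤ) with hq
  set t : Pt P.d := fun i => (q i - 1) / (P.L : ℤ) with ht
  set a' : Pt P.d := fun i => ((ρ : ℤ) * t i + (Mc : ℤ) - 1) / (Mc : ℤ) with ha'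
  -- the new corner is `ρ·t`
  have hcorner : ∀ i, cornerP P Mc ρ a' i = (ρ : ℤ) * t i := by
    intro i
    have hlo : (ρ : ℤ) * t i ≤ (Mc : ℤ) * a' i := by
      have := Int.lt_ediv_add_one_mul_self ((ρ : ℤ) * t i + (Mc : ℤ) - 1) hMc0
      simp only [ha'] at this ⊢
      nlinarith
    have hhi : (Mc : ℤ) * a' i < (ρ : ℤ) * (t i + 1) := by
      have := Int.ediv_mul_le ((ρ : ℤ) * t i + (Mc : ℤ) - 1) hMc0.ne'
      simp only [ha'] at this ⊢
      have hMcρ' : (Mc : ℤ) ≤ ρ := by exact_mod_cast hMcρ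
      nlinarith
    have h1 : t i ≤ (Mc : ℤ) * a' i / (ρ : ℤ) := Int.le_ediv_of_mul_le hρ0 ((mul_comm _ _).trans_le hlo)
    have h2 : (Mc : ℤ) * a' i / (ρ : ℤ) < t i + 1 := Int.ediv_lt_of_lt_mul hρ0 (hhi.trans_eq (mul_comm _ _))
    have h3 : (Mc : ℤ) * a' i / (ρ : ℤ) = t i := by omega
    simp only [cornerP, gridFloor, h3]
  have hcorner0 : ∀ i, cornerP P Mc ρ a i = (ρ : ℤ) * q i := fun i => by simp only [cornerP, gridFloor, hq]
  -- the side is `ρ·s`, `s ≥ 2`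
  obtain ⟨s, hs2, hside⟩ : ∃ s : ℕ, 2 ≤ s ∧ sideP P Mc ρ = ρ * s := ⟨(Mc + 11 * P.d) / ρ + 2, le_add_left (le_refl _), rfl⟩
  refine ⟨a', box_subset_box_succ_of_corner P.L (fun i => ?_) (fun i => ?_) n⟩
  · -- `L·ρt ≤ ρq − 1` from `L·⌊(q−1)/L⌋ ≤ q − 1` and `ρ ≥ 1`
    rw [hcorner, Pi.sub_apply, hcorner0]
    have h1 := Int.ediv_mul_le (q i - 1) hL0.ne'
    simp only [ht, Pi.one_apply]
    nlinarith
  · -- `ρq − 1 + (ρs + 2) ≤ L(ρt + ρs)` from `q − 1 < L(⌊(q−1)/L⌋ + 1)`, `s ≥ 2`, `L ≥ 3`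
    rw [hcorner, Pi.sub_apply, hcorner0, hside]
    push_cast
    have h1 := Int.lt_ediv_add_one_mul_self (q i - 1) hL0
    simp only [ht, Pi.one_apply]
    have hs2' : (2 : ℤ) ≤ s := by exact_mod_cast hs2
    have hq1 : q i - 1 + 1 ≤ ((q i - 1) / (P.L : ℤ) + 1) * (P.L : ℤ) := h1
    nlinarith [mul_nonneg (sub_nonneg.mpr hL3) (sub_nonneg.mpr hs2'), hρ0.le, mul_le_mul_of_nonneg_left hs2' hρ0.le]

end Boxes

/-! ## §2  The reduction: all meeting datums from the MARGIN-CLEAN meeting datums -/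

section Reduction

variable {P : Params} {N : ℕ}

/-- ★★★ **ALL DATUMS FROM THE MARGIN-CLEAN DATUMS** (generic torus `P`, any region sequence `Ω`, any field `U`): if the split clause holds at every datum `(j, a)`, `1 ≤ j ≤ k`, whose print box
comes within `3` of `Ω_j` AND is MARGIN-CLEAN (`j = k`, or the box WIDENED BY ONE LEVEL-`j` BLOCK carries no point of `Ω_{j+1}` — print's margin cube «□̃» missing `Ω_{j+1}`), and every widened
level-`j` print box lies in a level-`(j+1)` print box, then the clause holds at EVERY datum whose box comes within `3` of `Ω_j` (induction on `k − j`; MODULE 56 `.raise`).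
[cite: Balaban1985Variational, (144) p.300, p.300 («□ intersecting Ω_j but not Ω_{j+1}»), (147)–(150) p.301, (160) p.303, (165)–(168) p.304] -/
theorem localGaugeSplitOn_allDatums_of_marginClean (hL : 2 ≤ P.L) {Mc ρ : ℕ} (Ω : ℕ → Set (Site P 0)) (k : ℕ) (ε δ : ℕ → ℝ)
    {κ C θ Q : ℝ} (hκ : 0 ≤ κ) (hC : 0 ≤ C) (hθ : 0 ≤ θ) (hQ : 0 ≤ Q)
    (hε0 : ∀ n, n ≤ k → 0 ≤ ε n) (hδ0 : ∀ n, n ≤ k → 0 ≤ δ n)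
    (hεcomp' : ∀ n, n < k → ε (n + 1) ≤ 2 * ε n) (hδcomp' : ∀ n, n < k → δ (n + 1) ≤ 2 * δ n)
    (U : GaugeField P 0 (SU N))
    (hnest : ∀ j, 1 ≤ j → j < k → ∀ a : Pt P.d, (∃ z ∈ box P.L (cornerP P Mc ρ a - 1) (sideP P Mc ρ + 2) j, cover P z ∈ Ω (j + 1)) →
      ∃ a' : Pt P.d, box P.L (cornerP P Mc ρ a - 1) (sideP P Mc ρ + 2) j ⊆ box P.L (cornerP P Mc ρ a') (sideP P Mc ρ) (j + 1))
    (hclean : ∀ j, 1 ≤ j → j ≤ k → ∀ a : Pt P.d,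
      (∃ x ∈ box P.L (cornerP P Mc ρ a) (sideP P Mc ρ) j, ∃ y : Pt P.d, cover P y ∈ Ω j ∧ Within ((3 : ℕ) : ℤ) x y) →
      (j = k ∨ ∀ z ∈ box P.L (cornerP P Mc ρ a - 1) (sideP P Mc ρ + 2) j, cover P z ∉ Ω (j + 1)) →
      LocalGaugeSplitOn (cover P '' box P.L (cornerP P Mc ρ a) (sideP P Mc ρ) j) (P.eta j) (κ * ε j) (C * δ j + θ * ε j + Q * ε j ^ 2) U) :
    ∀ j, 1 ≤ j → j ≤ k → ∀ a : Pt P.d,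
      (∃ x ∈ box P.L (cornerP P Mc ρ a) (sideP P Mc ρ) j, ∃ y : Pt P.d, cover P y ∈ Ω j ∧ Within ((3 : ℕ) : ℤ) x y) →
      LocalGaugeSplitOn (cover P '' box P.L (cornerP P Mc ρ a) (sideP P Mc ρ) j) (P.eta j) (κ * ε j) (C * δ j + θ * ε j + Q * ε j ^ 2) U := by
  -- induction on the co-level `r = k − j`
  suffices H : ∀ r j, k - j = r → 1 ≤ j → j ≤ k → ∀ a : Pt P.d,
      (∃ x ∈ box P.L (cornerP P Mc ρ a) (sideP P Mc ρ) j, ∃ y : Pt P.d, cover P y ∈ Ω j ∧ Within ((3 : ℕ) : ℤ) x y) →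
      LocalGaugeSplitOn (cover P '' box P.L (cornerP P Mc ρ a) (sideP P Mc ρ) j) (P.eta j) (κ * ε j) (C * δ j + θ * ε j + Q * ε j ^ 2) U from
    fun j hj hjk a hmeet => H (k - j) j rfl hj hjk a hmeet
  intro r
  induction r with
  | zero =>
      intro j hr hj hjk a hmeet
      exact hclean j hj hjk a hmeet (Or.inl (by omega))
  | succ r ih =>
      intro j hr hj hjk a hmeet
      by_cases hin : ∃ z ∈ box P.L (cornerP P Mc ρ a - 1) (sideP P Mc ρ + 2) j, cover P z ∈ Ω (j + 1)
      · -- the WIDENED box meets `Ω_{j+1}`: raise the level (block tolerance: the widened box lies in a level-`(j+1)` print box)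
        have hjk' : j < k := by omega
        obtain ⟨a', hsub⟩ := hnest j hj hjk' a hin
        obtain ⟨z, hz, hzΩ⟩ := hin
        have hmeet' : ∃ x ∈ box P.L (cornerP P Mc ρ a') (sideP P Mc ρ) (j + 1), ∃ y : Pt P.d, cover P y ∈ Ω (j + 1) ∧ Within ((3 : ℕ) : ℤ) x y :=
          ⟨z, hsub hz, z, hzΩ, Within.refl (by norm_num) z⟩
        have hup := ih (j + 1) (by omega) (by omega) (by omega) a' hmeet'
        exact hup.raise (Set.image_mono ((box_subset_wbox P.L _ _ j).trans hsub)) hL j hκ hC hθ hQ (hε0 j hjk) (hδ0 j hjk) (hε0 (j + 1) (by omega))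
          (hεcomp' j hjk') (hδcomp' j hjk')
      · -- margin-clean datum
        push Not at hin
        exact hclean j hj hjk a hmeet (Or.inr hin)

/-- ★★★ **THE GUARDED PER-DATUM TOKEN FROM ITS MARGIN-CLEAN RESTRICTION** — print's «□ intersecting Ω_j but NOT Ω_{j+1}» read with print's MARGIN for the tree's grid datums: dag-n07-w4's
`DatumGaugeSplitTopStepCoreG F N Sup Mc ρ Adm B₃ C θ Q κ a₀ a₁` holds as soon as the SAME clause is supplied under the SAME prefix at the datums whose print box comes within `3` of `Ω_j` (box
form) AND is MARGIN-CLEAN: `j = k ∨` «the widened box `box L (cornerP a − 1) (sideP + 2) j` carries no point of `Ω_{j+1}`».  Side letters `1 ≤ Mc ≤ ρ` (§1), `0 ≤ B₃ κ C θ Q` (MODULE 56 §2);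
`3 ≤ L` is `F.hL11`.  A knit keyed on it owes the chart's rows only where the widened top box misses `Ω_{j+1}` (LOCATED-ADJACENT-RING's cure (c2), plan g87).
[cite: Balaban1985Variational, p.279 (class of cubes), (144) p.300, p.300 («□ intersecting Ω_j but not Ω_{j+1}»), (147)–(150) p.301, (160) p.303, (165)–(168) p.304, Prop. 8 p.304] -/
theorem datumGaugeSplitTopStepCoreG_of_marginClean (F : T4Family) (N : ℕ) [NeZero N]
    {Sup : (ν : Stage7Numerics) → (K : ℕ) → (ℕ → Set (Site (F.P K) 0)) → Set (Site (F.P K) 0)} {Mc ρ : ℕ} (hMc : 1 ≤ Mc) (hMcρ : Mc ≤ ρ)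
    {Adm : StepGuard F} {B₃ C θ Q κ a₀ a₁ : ℝ} (hB₃ : 0 ≤ B₃) (hκ : 0 ≤ κ) (hC : 0 ≤ C) (hθ : 0 ≤ θ) (hQ : 0 ≤ Q)
    (h : ∀ (ν : Stage7Numerics) (M : ℕ) (g : ℕ → ℝ) (K k : ℕ) (s : SeqOfRecord F ν M g K k), Sect2.SeqSeparated ν.M₁ s → 0 < ν.M₁ → Adm ν M g K k s → 1 ≤ k →
      ∀ (ε δ : ℕ → ℝ),
      (∀ n, n ≤ k → 0 < δ n ∧ δ n ≤ a₁) → (∀ n, n < k → δ n ≤ 2 * δ (n + 1)) → (∀ n, n < k → δ (n + 1) ≤ 2 * δ n) →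
      (∀ n, n ≤ k → B₃ * δ n ≤ ε n ∧ ε n ≤ a₀) → (∀ n, n < k → ε n ≤ 2 * ε (n + 1)) → (∀ n, n < k → ε (n + 1) ≤ 2 * ε n) →
      ∀ W : MSField (F.P K) (SU N), Sect2.DataSmall7PTop (avOfRecord F N K) s.Ω (Sup ν K s.Ω) k δ W →
        ∀ U : GaugeField (F.P K) 0 (SU N),
          (∀ n, n ≤ k → PlaqSmallOn (Sect2.omegaPlaqsTop s.Ω (Sup ν K s.Ω) n) (ε n * (F.P K).eta n ^ 2) U) →
          (∀ n, n ≤ k → Sect2.CoDivSmallOn (Sect2.omegaBondsTop s.Ω (Sup ν K s.Ω) n) (ε n * (F.P K).eta n ^ 3) U) →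
          AgreeOn (genSet s.Ω k) (avgFamily (avOfRecord F N K) U) W →
          IsCritOnFibre F N K (genSet s.Ω k) W U →
          ∀ j, 1 ≤ j → j ≤ k → ∀ a : Pt (F.P K).d,
            (∃ x ∈ box (F.P K).L (cornerP (F.P K) Mc ρ a) (sideP (F.P K) Mc ρ) j, ∃ y : Pt (F.P K).d, cover (F.P K) y ∈ s.Ω j ∧ Within ((3 : ℕ) : ℤ) x y) →
            (j = k ∨ ∀ z ∈ box (F.P K).L (cornerP (F.P K) Mc ρ a - 1) (sideP (F.P K) Mc ρ + 2) j, cover (F.P K) z ∉ s.Ω (j + 1)) →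
            LocalGaugeSplitOn (cover (F.P K) '' box (F.P K).L (cornerP (F.P K) Mc ρ a) (sideP (F.P K) Mc ρ) j)
              ((F.P K).eta j) (κ * ε j) (C * δ j + θ * ε j + Q * ε j ^ 2) U) :
    DatumGaugeSplitTopStepCoreG F N Sup Mc ρ Adm B₃ C θ Q κ a₀ a₁ := by
  intro ν M g K k s hsep hM₁ hadm hk ε δ hδ hcompδ hcompδ' hε hεcomp hεcomp' W h7 U h17 h19 hfib hcrit j hj hjk a hmeet
  have hL3 : 3 ≤ (F.P K).L := by have := F.hL11; rw [T4Family.P_L]; omega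
  have hL2 : 2 ≤ (F.P K).L := le_trans (by norm_num) hL3
  have hρ0 : 0 < ρ := lt_of_lt_of_le hMc hMcρ
  have hδ0 : ∀ n, n ≤ k → 0 ≤ δ n := fun n hn => (hδ n hn).1.le
  have hε0 : ∀ n, n ≤ k → 0 ≤ ε n := fun n hn => le_trans (mul_nonneg hB₃ (hδ0 n hn)) (hε n hn).1
  -- the token's meeting premise (grid cube within 3 of `Ω_j`) gives the box premise (`□ ⊆ 𝔔`)
  have hmeet' : ∃ x ∈ box (F.P K).L (cornerP (F.P K) Mc ρ a) (sideP (F.P K) Mc ρ) j, ∃ y : Pt (F.P K).d,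
      cover (F.P K) y ∈ s.Ω j ∧ Within ((3 : ℕ) : ℤ) x y := by
    obtain ⟨x, y, hx, hy, hw⟩ := hmeet
    exact ⟨x, cubeExt_side_subset_box_cornerP Mc hρ0 a j hx, y, hy, hw⟩
  exact localGaugeSplitOn_allDatums_of_marginClean hL2 s.Ω k ε δ hκ hC hθ hQ hε0 hδ0 hεcomp' hcompδ' U
    (fun j' _ _ a' _ => exists_cornerP_wbox_subset_succ hMc hMcρ hL3 a' j')
    (h ν M g K k s hsep hM₁ hadm hk ε δ hδ hcompδ hcompδ' hε hεcomp hεcomp' W h7 U h17 h19 hfib hcrit) j hj hjk a hmeet'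

end Reduction

end Summit.QuantumFields.YangMills.BalabanUVNodes.N07SplitClauseLevelRaisingMargin

end
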